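import Mathlib.Algebra.Polynomial.Roots
import Mathlib.LinearAlgebra.Lagrange
import Literature.InformationTheory.Coding.OnePointAGCodes
import HarnessLib

/-!
# One-point algebraic-geometry codes: the genus-zero model (Reed–Solomon codes)

Non-vacuity and sanity check of `Literature.InformationTheory.Coding.OnePointData`
(`OnePointAGCodes.lean`): the rational function field `F(X)` with `Q = ∞` and `n` distinct
finite rational places `X = αᵢ` gives one-point data with `R = F[X]`, `deg` = polynomial degree,
`ev` = evaluation at the `αᵢ` (onto by Lagrange interpolation; a nonzero polynomial of degree `≤ a`
has `≤ a` roots), and NO gaps (`X^a` has degree `a`), i.e. genus `0`. Its one-point codes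
`C(D, a·P_∞) = {(f(α_i))_i | deg f ≤ a}` are the rational AG codes = generalised Reed–Solomon
codes [Stichtenoth 2009, §2.3: Def. 2.3.1, Prop. 2.3.2 (`k = 1 + deg G`, `d = n - deg G`, MDS,
`C^⊥` again rational), Def. 2.3.4–Prop. 2.3.5], and the general theorems specialise to their MDS
parameters: `k = a + 1` (`a < n`), `d ≥ n - a` (and `d^⊥ ≥ a + 2` from `OnePointAGCodesDual.lean`).

## References

* H. Stichtenoth, *Algebraic Function Fields and Codes*, 2nd ed., GTM 254 (2009), §2.3
  (rational AG codes = generalised Reed–Solomon codes). Held.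
-/

noncomputable section

namespace Literature.InformationTheory.Coding

open Polynomial Finset

namespace OnePointData

variable {F : Type*} [Field F] {ι : Type*} [Fintype ι]

/-- **Reed–Solomon one-point data**: `R = F[X]`, pole order at `∞` = degree, evaluation at
distinct points `α : ι ↪ F`. [cite: Stichtenoth2009, Def. 2.3.1, Def. 2.3.4 and Prop. 2.3.5] -/
def reedSolomon (α : ι → F) (hα : Function.Injective α) : OnePointData F F[X] ι where
  deg := Polynomial.degree
  deg_eq_bot_iff' _ := Polynomial.degree_eq_bot
  deg_algebraMap' c hc := by rw [Polynomial.algebraMap_eq, Polynomial.degree_C hc]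
  deg_add_le' f g := Polynomial.degree_add_le f g
  deg_mul' _ _ := Polynomial.degree_mul
  exists_deg_sub_smul_lt' f g hf hfg := by
    have hg : g ≠ 0 := by
      rintro rfl
      rw [degree_zero, degree_eq_bot] at hfg
      exact hf hfg
    have hlg : g.leadingCoeff ≠ 0 := leadingCoeff_ne_zero.2 hg
    have hc : f.leadingCoeff / g.leadingCoeff ≠ 0 := div_ne_zero (leadingCoeff_ne_zero.2 hf) hlg
    refine ⟨f.leadingCoeff / g.leadingCoeff, Polynomial.degree_sub_lt ?_ hf ?_⟩
    · rw [smul_eq_C_mul, degree_C_mul hc, hfg]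
    · rw [smul_eq_C_mul, leadingCoeff_mul, leadingCoeff_C, div_mul_cancel₀ _ hlg]
  ev := AlgHom.pi fun i => Polynomial.aeval (α i)
  ev_surjective' v := by
    classical
    refine ⟨Lagrange.interpolate Finset.univ α v, funext fun i => ?_⟩
    simp only [AlgHom.pi_apply, coe_aeval_eq_eval]
    exact Lagrange.eval_interpolate_at_node v (hα.injOn.mono (Set.subset_univ _)) (Finset.mem_univ i)
  card_le_of_ev_eq_zero' f a hf hfa s hs := by
    classical
    have h1 : s.card = (s.image α).card := (Finset.card_image_of_injective s hα).symm
    have h2 : s.image α ⊆ f.roots.toFinset := by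
      intro x hx
      obtain ⟨i, hi, rfl⟩ := Finset.mem_image.1 hx
      rw [Multiset.mem_toFinset, mem_roots hf, IsRoot.def]
      have := hs i hi
      simpa [AlgHom.pi_apply, coe_aeval_eq_eval] using this
    calc s.card = (s.image α).card := h1
      _ ≤ f.roots.toFinset.card := Finset.card_le_card h2
      _ ≤ Multiset.card f.roots := Multiset.toFinset_card_le _
      _ ≤ f.natDegree := card_roots' f
      _ ≤ a := natDegree_le_iff_degree_le.2 hfa
  finite_gaps' := by
    have h : {a : ℕ | ∀ f : F[X], Polynomial.degree f ≠ a} = ∅ :=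
      Set.eq_empty_of_forall_notMem fun a ha => ha (X ^ a) (by simp)
    rw [h]
    exact Set.finite_empty

/-- Every natural number is a pole number of `P_∞` in `F(X)` (`deg X^a = a`). [folklore] -/
theorem isPoleNumber_reedSolomon (α : ι → F) (hα : Function.Injective α) (a : ℕ) :
    (reedSolomon α hα).IsPoleNumber a :=
  ⟨X ^ a, by simp [reedSolomon]⟩

/-- The rational function field has genus `0`: no gaps at `P_∞`.
[cite: Stichtenoth2009, Prop. 2.3.2 (c)] -/
theorem genus_reedSolomon (α : ι → F) (hα : Function.Injective α) :
    (reedSolomon α hα).genus = 0 := by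
  rw [genus, Finset.card_eq_zero, Finset.eq_empty_iff_forall_notMem]
  intro a ha
  exact (mem_gaps _).1 ha (isPoleNumber_reedSolomon α hα a)

/-- **Reed–Solomon dimension:** `dim C(D, a·P_∞) = a + 1` for `a < n`.
[cite: Stichtenoth2009, Prop. 2.3.2 (c)] -/
theorem finrank_code_reedSolomon (α : ι → F) (hα : Function.Injective α) {a : ℕ}
    (ha : a < Fintype.card ι) : Module.finrank F ((reedSolomon α hα).code a) = a + 1 := by
  have h := (reedSolomon α hα).finrank_code_add_genus (a := a)
    (by rw [genus_reedSolomon]; exact Nat.zero_le _) ha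
  rwa [genus_reedSolomon, add_zero] at h

variable [DecidableEq F]

/-- **Reed–Solomon distance:** nonzero codewords of `C(D, a·P_∞)` have weight `≥ n - a`.
[cite: Stichtenoth2009, Prop. 2.3.2 (c)] -/
theorem card_le_add_hammingNorm_reedSolomon (α : ι → F) (hα : Function.Injective α) {a : ℕ}
    {c : ι → F} (hc : c ∈ (reedSolomon α hα).code a) (h0 : c ≠ 0) :
    Fintype.card ι ≤ a + hammingNorm c :=
  (reedSolomon α hα).card_le_add_hammingNorm hc h0

end OnePointData

/-- Non-vacuity: one-point data exist (Reed–Solomon data on `𝔽_q` itself, `α = id`). [folklore] -/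
example {F : Type*} [Field F] [Fintype F] : OnePointData F F[X] F :=
  OnePointData.reedSolomon id Function.injective_id

end Literature.InformationTheory.Coding

end
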